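import Literature.MathematicalPhysics.QuantumFieldTheory.Balaban1983to89.B9Cor36CinvCubeLocLetterMajorant
import Literature.MathematicalPhysics.QuantumFieldTheory.Balaban1983to89.B9Thm39CinvTorusRegular
import Literature.MathematicalPhysics.QuantumFieldTheory.Balaban1983to89.B9Ineq368PPrime

/-!
# `Balaban1983to89.B9Cor36CinvCubeLocDefectTransfer` — THE DEFECT `E_□` OF THE C-JUNCTION AS A MEMBER-SIDE SANDWICH OF A CUBE-SIDE OPERATOR LOCALISED TO
# THE BLOCKS CARRYING `h_□`, AND ITS BLOCK MAJORANT TRANSFERRED FROM THE CUBE SEQUENCE's BLOCKS — the displayed input `hEd` of p21's M5.6 defect edition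
# `B9Thm39CinvAtCoverLargeDefect.cinv_cover_large_defect` REDUCED to ONE cube-side localized majorant (sub-row G-B9-LETTERS, module M5.2-E, FILE E2-3a;
# design (β) of `lit-balaban-p21/M52E-DESIGN-p21.md`, GAPS.md G-B9-p21-01)

T. Bałaban, *Propagators for lattice gauge theories in a background field*, Commun. Math. Phys. **99** (1985) 389–434
[`Balaban1985BackgroundPropagators`, "B9"]; [4] = T. Bałaban, *Propagators and renormalization transformations for lattice gauge
theories. II*, Commun. Math. Phys. **96** (1984) 223–250 [`Balaban1984PropagatorsII`].

statement-level skeleton of published theorems with citation tags; proofs where landed; nothing here is a claim about the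
Yang–Mills mass gap

THE PRINTED LOCUS (verbatim, held `paper:balaban1985-cmp99-background-propagators`, journal page = PDF page + 388).  (3.95) p. 411 l. 5–10 (the three sums and
«By the same estimates as in [4], especially (2.83)-(2.85), we can see that the operator R is small»); p. 412 l. 31–36: *«the differences □̃Q′(G′²_{□₀} − G′²_□)Q′\*□̃
can be estimated by the usual factors multiplied by e^{−2δ₀M}. We have to notice only that the operators may differ outside □̃₀, and the distance from □̃ to □̃₀ is
at least M»*; [4] (2.83)–(2.85) pp. 237–238 (the partial estimates: localized products of block majorants with separated supports gain `e^{−δ₀·distance}`); (2.51)–(2.55)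
p. 232.

WHY THIS FILE.  FILE E2-1 (`B9Cor36CinvCubeLocLetter`) displays the defect of the record's C-junction in closed form,
`E_□ = −R_b(u)⁻¹∘M_h∘J∘D∘R_c(u)∘1_N∘J⋆∘M_h`, `D = cinvDefectCoreY = [X̂(Ṽ)(1 − 1_N) + Q′_□G′_□(1 − M_χ²)G′_□Q′_□\*(Ṽ)1_N]∘Ĉ(Ṽ)`, and p21's M5.6 defect edition asks for
`hEd : conj b (E_□) ≺ κ_E·e^{−a_Xδ₀D_sep}·e^{−a_Eδ₀d(a,a′)}` over the member's blocks.  The smallness lives on the cube side and ONLY on the rows and columns of `D`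
that `M_h` lets through — the cube blocks `S` twinned with `supp h_□` — which are `≥ D_sep` away from the complement of `N` (the truncation part) and from the
support of `1 − χ²` (the inner part).  THIS FILE isolates that:
* §1 ★ `cinvLocDefectY_restrictScalars_eq`: for `S ⊂ N` containing the twins of `supp h`, `E_□ = −M_h·[J·1_S·R_c(u)⁻¹·(1_S·D·1_S)·R_c(u)·1_S·J⋆]·M_h` EXACTLY
  (the `1_N` on the right of `E_□` may be replaced by `1_S`, and `1_S` inserted after `J`, because `M_h` kills every other row ∕ column; `R_c(u)` commutes with
  the scalar truncations) — the bracket is FILE E2-2's bridge–sandwich at the cube-side operator `1_S·D·1_S`.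
* §2 ★★ `hasMajorant_conj_cinvLocDefectY`: M5.6's `hEd` FROM ONE CUBE-SIDE DATUM `conj b (1_S·D·1_S) ≺ K_C` over any geometry on the cube sequence's blocks, a
  bi-contractive gauge, `|h| ≤ 1`, and a member kernel `K ≥ 0` dominating `(M₂Σ‖b‖)²K_C` on `S` (FILE E2-2's transfer + `conj b (M_h) = mulOp h` + sign, r06's `B9Ineq368PPrime.hasMajorant_neg`).
  The cube-side datum itself — [4] (2.83)–(2.85) at the cube: products of the (3.42)₁∕(3.48)-majorants of `X̂`, `G′_□`, `Ĉ` with the separated truncations,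
  (2.61) and the scale transfer over the cube geometry — is FILE E2-3b.

HONEST SCOPE.  Finite operator algebra and bookkeeping of [4] (2.51)-majorants; NO estimate of [B9] is proved (the cube-side localized majorant `hD` is a
HYPOTHESIS — FILE E2-3b; its (3.48) ingredient is FILE E2-4, blocked on the C-clause carrier repair R-Ker-1, INTERFACES-r06 §111).  (R)-DESIGN TERM, NOT IN
PRINT (G-B9-p21-01): print's `C_□` makes `E_□ = 0`.  Inhabited: `h := 0` gives `E_□ = 0 ≺ K` for every `K ≥ 0`; `S := N :=` the twins of `supp h` satisfies the
support hypotheses — not a vacuous schema.  Count-neutral; no summit ∕ sub-problem statement is proved; nothing continuum ∕ OS ∕ mass-gap ∕ Clay.  No `sorry`,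
no `axiom`, no `… : Prop` fact, no `instance`, no `notation`, no `def`.  NEW file; nothing landed is modified.  Cell `lit-balaban`, seat `lit-balaban-p21` gen 34,
2026-08-28; `--supports stmt-QuantumFields-19200` as helper.  Net new unproved facts: 0.

RELATED IN THE TREE, NOT DUPLICATED (searched 2026-08-28): p21 `B9Cor36CinvCubeLocLetter` (E2-1), `B9Cor36CinvCubeLocLetterMajorant` (E2-2:
`hasMajorant_conj_bridge_sandwich`); p21 `B9Thm39CinvTorusRegular.conj_cutMulY`, p38∕p21 `B9Thm37Sum.mulOp`; pv08 `B6RandomWalk` (`HasMajorant`); r06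
`B9Thm39CinvFirstSum.firstSum_term_majorant_blk` (the generic separated-product estimate E2-3b will use) — USED BY NAME; no existing module modified.
-/

noncomputable section

namespace Literature.MathematicalPhysics.QuantumFieldTheory.Balaban1983to89.B9Cor36CinvCubeLocDefectTransfer

open Literature.MathematicalPhysics.QuantumFieldTheory.Balaban1983to89.B9Eq39Adjoint (R)
open Literature.MathematicalPhysics.QuantumFieldTheory.Balaban1983to89.B6KLevelCensusIndexV1 (KIdx)
open Literature.MathematicalPhysics.QuantumFieldTheory.Balaban1983to89.B6Cover236MultiLevelBlocks (cubes)
open Literature.MathematicalPhysics.QuantumFieldTheory.Balaban1983to89.B6Geom246MultiLevelBox (bset)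
open Literature.MathematicalPhysics.QuantumFieldTheory.Balaban1983to89.B6RandomWalk (HasMajorant BlockSupp)
open Literature.MathematicalPhysics.QuantumFieldTheory.Balaban1983to89.B9Thm34Ext (toB6)
open Literature.MathematicalPhysics.QuantumFieldTheory.Balaban1983to89.B9Eq352DivFormLetters (conj conj_neg)
open Literature.MathematicalPhysics.QuantumFieldTheory.Balaban1983to89.B9Thm37Sum (mulOp mulOp_apply)
open Literature.MathematicalPhysics.QuantumFieldTheory.Balaban1983to89.B9Thm39CinvTorusRegular (conj_cutMulY)
open Literature.MathematicalPhysics.QuantumFieldTheory.Balaban1983to89.B9CubeLettersOpsL0 (cubeFamY)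
open Literature.MathematicalPhysics.QuantumFieldTheory.Balaban1983to89.B9CubeLettersBondOpsL0 (BlkCubeY)
open Literature.MathematicalPhysics.QuantumFieldTheory.Balaban1983to89.B9Cor36CinvCubeLocLetter (cubeToBlkY blkToCubeY cubeToBlkY_apply_of_mem
  cubeToBlkY_apply_of_not_mem blkToCubeY_apply_of_mem blkToCubeY_apply_of_not_mem cubeBlkInd cubeBlkInd_apply gBlkCubeY cinvDefectCoreY cinvLocDefectY
  conjY_gBlkY_inv_cubeToBlkY cutMulY_conjY_apply cutMulY_cutMulY_apply)
open Literature.MathematicalPhysics.QuantumFieldTheory.Balaban1983to89.B9Cor36CinvCubeLocLetterMajorant (hasMajorant_conj_bridge_sandwich)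
open Literature.MathematicalPhysics.QuantumFieldTheory.Balaban1983to89.B9Thm37CubeCoverCommutators (cutMulY cutMulY_apply)
open Literature.MathematicalPhysics.QuantumFieldTheory.Balaban1983to89.Node00 (SiteY BlkY CfgY SiteParY GaugeY conjY conjY_apply gSiteY gBlkY toKT)

variable {d ℓ : ℕ} {hd : 1 ≤ d + 1} {hL : Odd (ℓ + 1) ∧ 1 < ℓ + 1} {b₀ b₁ : ℝ}
variable {𝔸 : Type} [NormedRing 𝔸] [NormedAlgebra ℂ 𝔸] [CompleteSpace 𝔸] {ι : Type} [Fintype ι]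

/-! ## §1 The defect as a member-side sandwich of the cube-side operator `1_S·D·1_S` -/

section Identity

variable (i : KIdx d ℓ hd hL b₀ b₁) (q : ↥(cubes (toKT i).D.toDomains)) (parS : SiteParY 𝔸 i)

omit [CompleteSpace 𝔸] in
/-- the right truncation of `E_□` may be taken at `S`: `1_N·J⋆·M_h = 1_S·J⋆·M_h` when `S ⊂ N` contains the twins of `supp h`.
[cite: Balaban1984PropagatorsII, (2.79)–(2.82) p.237, bookkeeping] -/
theorem ind_blkToCubeY_cutMulY_eq (N S : Finset (BlkCubeY i q)) (hSN : S ⊆ N) (h : BlkY i → ℝ) (hS : ∀ t, h t ≠ 0 → ∃ s ∈ S, s.1 = t.1)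
    (v : BlkY i → 𝔸) :
    cutMulY (cubeBlkInd i q N) (blkToCubeY i q (cutMulY h v)) = cutMulY (cubeBlkInd i q S) (blkToCubeY i q (cutMulY h v)) := by
  funext s
  rw [cutMulY_apply, cutMulY_apply, cubeBlkInd_apply, cubeBlkInd_apply]
  by_cases hs : s.1 ∈ bset i.D.toDomains
  · rw [blkToCubeY_apply_of_mem i q _ hs, cutMulY_apply]
    by_cases ht : h ⟨s.1, hs⟩ = 0
    · rw [ht, Complex.ofReal_zero, zero_smul, smul_zero, smul_zero]
    · obtain ⟨s₁, hs₁S, hs₁⟩ := hS _ ht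
      have e : s₁ = s := Subtype.ext hs₁
      rw [if_pos (hSN (e ▸ hs₁S)), if_pos (e ▸ hs₁S)]
  · rw [blkToCubeY_apply_of_not_mem i q _ hs, smul_zero, smul_zero]

omit [CompleteSpace 𝔸] in
/-- a truncation at `S` may be inserted after `J` under `M_h`: `M_h·J·1_S = M_h·J` when `S` contains the twins of `supp h`.
[cite: Balaban1984PropagatorsII, (2.79)–(2.82) p.237, bookkeeping] -/
theorem cutMulY_cubeToBlkY_ind_eq (S : Finset (BlkCubeY i q)) (h : BlkY i → ℝ) (hS : ∀ t, h t ≠ 0 → ∃ s ∈ S, s.1 = t.1)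
    (w : BlkCubeY i q → 𝔸) :
    cutMulY h (cubeToBlkY i q (cutMulY (cubeBlkInd i q S) w)) = cutMulY h (cubeToBlkY i q w) := by
  funext t
  rw [cutMulY_apply, cutMulY_apply]
  by_cases ht : h t = 0
  · rw [ht, Complex.ofReal_zero, zero_smul, zero_smul]
  obtain ⟨s, hsS, hst⟩ := hS t ht
  have ht' : t.1 ∈ B6Geom246MultiLevelBoxL0.bset (cubeFamY i q).toDomains := hst ▸ s.2
  have hs : (⟨t.1, ht'⟩ : BlkCubeY i q) = s := Subtype.ext hst.symm
  rw [cubeToBlkY_apply_of_mem i q _ ht', cubeToBlkY_apply_of_mem i q _ ht', hs, cutMulY_apply, cubeBlkInd_apply, if_pos hsS,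
    Complex.ofReal_one, one_smul]

omit [CompleteSpace 𝔸] in
/-- a `{0,1}`-valued truncation is idempotent, applied. [cite: Balaban1984PropagatorsII, (2.79) p.237, bookkeeping] -/
theorem ind_ind_apply (S : Finset (BlkCubeY i q)) (w : BlkCubeY i q → 𝔸) :
    cutMulY (cubeBlkInd i q S) (cutMulY (cubeBlkInd i q S) w) = cutMulY (cubeBlkInd i q S) w := by
  rw [cutMulY_cutMulY_apply]
  exact congrArg (fun f => cutMulY (𝔸 := 𝔸) f w) (funext fun s => by
    rw [cubeBlkInd_apply]; split_ifs <;> norm_num)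

/-- ★ **THE DEFECT AS A MEMBER-SIDE SANDWICH OF THE LOCALISED CUBE-SIDE OPERATOR**: for `S ⊂ N` containing the twins of `supp h`,
`E_□|_ℝ = −M_h·[J·1_S·R_c(u)⁻¹·(1_S·D·1_S)·R_c(u)·1_S·J⋆]·M_h`, the bracket in the exact shape of FILE E2-2's `hasMajorant_conj_bridge_sandwich`.
[cite: Balaban1985BackgroundPropagators, (3.95) p.411, p.412 l.31–36; Balaban1984PropagatorsII, (2.82)–(2.85) pp.237–238] -/
theorem cinvLocDefectY_restrictScalars_eq (g : GaugeY 𝔸 i) (χ : SiteY i → ℝ) (V : CfgY 𝔸 i) (N S : Finset (BlkCubeY i q)) (h : BlkY i → ℝ)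
    (hSN : S ⊆ N) (hS : ∀ t, h t ≠ 0 → ∃ s ∈ S, s.1 = t.1) :
    (cinvLocDefectY i q parS g χ V N h).restrictScalars ℝ =
      -((cutMulY (𝔸 := 𝔸) h).restrictScalars ℝ *
          ((cubeToBlkY (𝔸 := 𝔸) i q).restrictScalars ℝ ∘ₗ (cutMulY (𝔸 := 𝔸) (cubeBlkInd i q S)).restrictScalars ℝ ∘ₗ
            (conjY (gBlkCubeY i q g)⁻¹).restrictScalars ℝ ∘ₗ
              ((cutMulY (𝔸 := 𝔸) (cubeBlkInd i q S)).restrictScalars ℝ ∘ₗ (cinvDefectCoreY i q parS χ V N).restrictScalars ℝ ∘ₗ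
                (cutMulY (𝔸 := 𝔸) (cubeBlkInd i q S)).restrictScalars ℝ) ∘ₗ
            (conjY (gBlkCubeY i q g)).restrictScalars ℝ ∘ₗ (cutMulY (𝔸 := 𝔸) (cubeBlkInd i q S)).restrictScalars ℝ ∘ₗ
            (blkToCubeY (𝔸 := 𝔸) i q).restrictScalars ℝ) *
        (cutMulY (𝔸 := 𝔸) h).restrictScalars ℝ) := by
  refine LinearMap.ext fun v => ?_
  simp only [cinvLocDefectY, LinearMap.neg_apply, LinearMap.restrictScalars_apply, LinearMap.comp_apply, Module.End.mul_apply]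
  -- right end: `1_N J⋆ M_h = 1_S J⋆ M_h`; `R_c 1_S = 1_S R_c`, `1_S 1_S = 1_S`
  rw [ind_blkToCubeY_cutMulY_eq i q N S hSN h hS v, ← cutMulY_conjY_apply (gBlkCubeY i q g) (cubeBlkInd i q S), ind_ind_apply]
  -- left end: `1_S R_c⁻¹ = R_c⁻¹ 1_S`, `J R_c⁻¹ = R_b⁻¹ J`, `M_h R_b⁻¹ = R_b⁻¹ M_h`, `M_h J 1_S = M_h J`
  rw [cutMulY_conjY_apply (gBlkCubeY i q g)⁻¹ (cubeBlkInd i q S), ind_ind_apply, ← conjY_gBlkY_inv_cubeToBlkY,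
    cutMulY_conjY_apply (gBlkY i g)⁻¹ h, cutMulY_cubeToBlkY_ind_eq i q S h hS]

end Identity

/-! ## §2 M5.6's `hEd` from one cube-side localized majorant -/

section Majorant

variable (i : KIdx d ℓ hd hL b₀ b₁) (q : ↥(cubes (toKT i).D.toDomains)) (parS : SiteParY 𝔸 i) (b : Module.Basis ι ℝ 𝔸)

/-- a two-sided multiplication by a function of modulus `≤ 1` keeps a majorant (generic block geometry).
[cite: Balaban1984PropagatorsII, (2.52) p.232, bookkeeping] -/
private theorem hasMajorant_mulOp_sandwich' {G : B6.Geometry} {X : Type} (blk : X → G.Site) {T : Module.End ℝ (X → ℝ)} {K : G.Site → G.Site → ℝ}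
    (hT : HasMajorant (g := G) blk T K) (f : X → ℝ) (hf : ∀ x, |f x| ≤ 1) :
    HasMajorant (g := G) blk (mulOp f * T * mulOp f) K := by
  intro y' μ B hμ x
  have hμ' : BlockSupp (g := G) blk (mulOp f μ) y' B :=
    ⟨hμ.nonneg, fun x' hx' => by
      rw [mulOp_apply, abs_mul]
      exact (mul_le_of_le_one_left (abs_nonneg _) (hf x')).trans (hμ.bound x' hx'),
     fun x' hx' => by rw [mulOp_apply, hμ.off x' hx', mul_zero]⟩
  rw [Module.End.mul_apply, Module.End.mul_apply, mulOp_apply, abs_mul]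
  exact (mul_le_of_le_one_left (abs_nonneg _) (hf x)).trans (hT y' _ B hμ' x)

/-- ★★ **M5.6's `hEd` FROM ONE CUBE-SIDE LOCALIZED MAJORANT**: if the cube-side operator `1_S·D·1_S` (the defect core of FILE E2-1 truncated to a set `S ⊂ N` of cube
blocks containing the twins of `supp h_□`) has `conj b (1_S·D·1_S) ≺ K_C` over a geometry `g_C` on the cube sequence's blocks, the block gauge `u` is bi-contractive,
`|h_□| ≤ 1`, and `K ≥ 0` dominates `(M₂Σ_j‖b_j‖)²K_C` on `S` under an injective member block map `τ` (M5.6: `τ = ιB`, `K(a,a′) = κ_E·e^{−a_Xδ₀D_sep}·e^{−a_Eδ₀d(a,a′)}`),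
then `conj b (E_□) ≺ K` over the member's geometry.
[cite: Balaban1985BackgroundPropagators, (3.95) p.411, p.412 l.31–36, Cor. 3.6 p.408 l.11–14; Balaban1984PropagatorsII, (2.82)–(2.85) pp.237–238, (2.51)–(2.52) p.232] -/
theorem hasMajorant_conj_cinvLocDefectY {M₂ : ℝ} (hM₂ : 0 ≤ M₂) (hrepr : ∀ (v : 𝔸) (j : ι), |b.repr v j| ≤ M₂ * ‖v‖)
    (g : GaugeY 𝔸 i) (hg : ∀ z a, ‖R (gSiteY i g z) a‖ ≤ ‖a‖ ∧ ‖R (gSiteY i g z)⁻¹ a‖ ≤ ‖a‖) (χ : SiteY i → ℝ) (V : CfgY 𝔸 i)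
    (N S : Finset (BlkCubeY i q)) (h : BlkY i → ℝ) (hSN : S ⊆ N) (hS : ∀ t, h t ≠ 0 → ∃ s ∈ S, s.1 = t.1) (hh1 : ∀ t, |h t| ≤ 1)
    {gC : B6.Geometry} (σ : BlkCubeY i q → gC.Site) {gD : B9.Geometry} [Fintype gD.Site] {Rr : ℝ} {Hp : Prop} (τ : BlkY i → gD.Site)
    (hτ : Function.Injective τ) {KC : gC.Site → gC.Site → ℝ} {K : gD.Site → gD.Site → ℝ} (hK : ∀ a a', 0 ≤ K a a')
    (hcmp : ∀ s ∈ S, ∀ s' ∈ S, ∀ (hs : s.1 ∈ bset i.D.toDomains) (hs' : s'.1 ∈ bset i.D.toDomains),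
      (M₂ * ∑ j, ‖b j‖) ^ 2 * KC (σ s) (σ s') ≤ K (τ ⟨s.1, hs⟩) (τ ⟨s'.1, hs'⟩))
    (hD : HasMajorant (g := gC) (fun p : BlkCubeY i q × ι => σ p.1)
      (conj b ((cutMulY (𝔸 := 𝔸) (cubeBlkInd i q S)).restrictScalars ℝ ∘ₗ (cinvDefectCoreY i q parS χ V N).restrictScalars ℝ ∘ₗ
        (cutMulY (𝔸 := 𝔸) (cubeBlkInd i q S)).restrictScalars ℝ)) KC) :
    HasMajorant (g := toB6 gD Rr Hp) (fun p : BlkY i × ι => τ p.1) (conj b ((cinvLocDefectY i q parS g χ V N h).restrictScalars ℝ)) K := by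
  rw [cinvLocDefectY_restrictScalars_eq i q parS g χ V N S h hSN hS, conj_neg, B9Eq352DivFormLetters.conj_mul, B9Eq352DivFormLetters.conj_mul,
    conj_cutMulY]
  refine B9Ineq368PPrime.hasMajorant_neg _ (hasMajorant_mulOp_sandwich' _ ?_ _ fun p => hh1 p.1)
  exact hasMajorant_conj_bridge_sandwich i q b hM₂ hrepr (gBlkCubeY i q g) (fun s a => hg _ a) S (gD := toB6 gD Rr Hp) σ τ hτ
    (K := K) hK hcmp _ hD

end Majorant

end Literature.MathematicalPhysics.QuantumFieldTheory.Balaban1983to89.B9Cor36CinvCubeLocDefectTransfer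

end
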